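import Summits.QuantumFields.BalabanUV.Beta.FP.MixLoopPowerCountingMassQuartic
import Summits.QuantumFields.BalabanUV.Beta.FP.MixLoopPowerCountingGamma

/-!
# `BalabanUV.Beta.FP.MixLoopPowerCountingMassGamma` — road «FP» (binder row D1), row **RHOA-6c′** «MASS-CURRENCY POWER COUNTING OF THE MIX LOOPS», the
# **(MIX-1)** twin `tr(G_C·Q̇Γ₀Q̇ᵀ)`: FILE B's vertex-first bound with the uniform letters (`Σ_u|q̇(u;b,b+w)| ≤ A∕n⁴`, `#W ≤ N₀·n`) replaced by the INLINE pointwise-in-leg mass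
# `m₁(b,w) = Σ_{u∈U b}|q̇(u;b,b+w)|`, and the second moment taken for the COARSE J-contracted kernel in the road-FP OWNER's mass currency (R-FP-26)
# ([folklore] lattice bookkeeping on `ℤ⁴`; abstract kernels, every letter a displayed hypothesis; NO road object)

HONEST DEPENDENCY (page 1, mandatory): continuum YM on T⁴ ⇐ BetaPertH ∧ nine spine estimates (0/9 proved); BetaPertH ⇐ (D1) ∧ (D4) ∧
CAP+tail; G-an2-4 gates asym, D1 and NE2/3/4.  HONEST FRAMING (cell contract, verbatim): «discharging `BetaPertH` makes Bałaban's UV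
stability UNCONDITIONAL — a real constructive-QFT result; it is NOT the continuum limit and NOT the Clay problem.»  THIS MODULE is elementary
[folklore] real analysis on `ℤ⁴` over `MixLoopPowerCountingMassQuartic.coarse_secondMoment_of_majorant` (the J-contraction lemma) and FILE B's `MixLoopPowerCountingGamma.sum_comm₄`;
it asserts nothing about Bałaban's objects, cites nothing, mints no `Prop` fact, has no `def`, 0 sorry.  NOT `Mix_n = O(1)` for Bałaban's objects (row RHOA-6e assembles), NOT `hbook`,
NOT D1, NOT BetaPertH, NOT continuum, NOT Clay.

WHY (R-FP-26, `ROOTING-MIX.md` §2): for ROOTED averaging jets FILE B's per-pair sup letter `Σ_u|q̇(u;b,b+w)| ≤ A∕n⁴` still holds, but its offset-count letter `#W ≤ N₀·n` does not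
(the radial field legs fill the block); the insertion-point mass is trunk-concentrated while the FIELD-POINT mass stays uniform.  So the (MIX-1) majorant is written with both
masses INLINE and two windowed letters: the owner's (M) on the insertion side and the Γ₀-PROFILE-WINDOWED FIELD-POINT MASS (M̃Γ) on the field side — NO power of `n` is displayed
outside the letters (R-FP-26 (e): instance powers are RHOA-6e's bookkeeping).
THE LETTERS (`n ≥ 1`, radius multiplier `R`): (G₀) `|G u u′| ≤ C_G` (plain sup; its coarse exponential stays idle); (Γ) `|Γ c c′| ≤ C_Γ(‖c−c′‖+1)⁻²e^{−(δ∕n)‖c−c′‖}`; (W) `‖w‖ ≤ R·n`;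
(J) `|J b v₀| ≤ C_Je^{−(δ∕n)‖b−n•v₀‖}`; (J′) `Σ_{v∈V}(1 + ‖b′−n•v‖²∕n²)|J b′ v| ≤ C_J′`; (M) `Σ_{b∈S} e^{−(δ∕(2n))‖b−n•v₀‖}·M(b) ≤ A_M`, `M(b) = Σ_{w}m₁(b,w)` INLINE;
**(M̃Γ)** `∀ c, Σ_{b′∈S}Σ_{w′∈W} ((‖c−(b′+w′)‖+1)⁻² + n⁻²)·e^{−(δ∕(2n))‖c−(b′+w′)‖}·m₁(b′,w′) ≤ Ã` (the field-point mass is `≍ (2d+2)·n⁻³` uniformly for straight AND rooted jets,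
so `Ã ≍ n⁻¹` in lattice units, against `C_G ≍ n²`, `C_JC_J′A_M ≍ n⁻¹` — RHOA-6e's bookkeeping).
CONTENT: `abs_mix1_le_vertexMass` (`|k₁(b,b′)| ≤ C_G·Σ_{w,w′}m₁(b,w)m₁(b′,w′)|Γ₀(b+w,b′+w′)|`), `profile_weight_le` (`|Γ₀(c,c′)|·(1 + ‖b′−b‖²∕n²) ≤ C_Γ(3 + 8R²)·((‖c−c′‖+1)⁻² + n⁻²)·
e^{−(δ∕2n)‖c−c′‖}` for `c = b + w`, `c′ = b′ + w′`), `windowedMajorant_mix1_le` ((Mκ₁) `≤ C_G·C_Γ(3 + 8R²)·Ã·A_M`), **`coarse_mix1_secondMoment_le`**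
(`Σ_{v∈V}‖v−v₀‖∞²·|Σ_{b,b′∈S}J b v₀·J b′ v·k₁(b,b′)| ≤ 3C_JC_J′(1 + 16∕δ²)·C_GC_Γ(3 + 8R²)·Ã·A_M`).
Provenance: cross-cell idle-seat kernel duty NE7b → β∕D1, unit `b2b-balaban-t4-ne7b-formalise-leaf-01` gen 23 (first-refusal holder of RHOA-6c′), 2026-08-21; «not in print; our
bookkeeping»; no existing file touched.
-/

noncomputable section

namespace Summit.QuantumFields.BalabanUV.Beta.FP.MixLoopPowerCountingMassGamma

open Finset Real
open scoped BigOperators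
open Literature.MathematicalPhysics.QuantumFieldTheory.Balaban1983to89.Beta.DyadicShell (Pt supNorm)
open Literature.MathematicalPhysics.QuantumFieldTheory.Balaban1983to89.Beta.BlockLegs (supNorm_sub_le_real supNorm_add_le_real)
open Summit.QuantumFields.BalabanUV.Beta.FP.MixLoopPowerCounting (supNorm_cast_nonneg)
open Summit.QuantumFields.BalabanUV.Beta.FP.MixLoopPowerCountingGamma (sum_comm₄)
open Summit.QuantumFields.BalabanUV.Beta.FP.MixLoopPowerCountingMassQuartic (coarse_secondMoment_of_majorant)

section Mix1

variable {U : Pt → Finset Pt} {W : Finset Pt} {qd : Pt → Pt → Pt → ℝ} {G Γ J : Pt → Pt → ℝ} {C_G C_Γ C_J C_J' A_M Ã δ : ℝ} {n R : ℕ}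

/-- **(MIX-1) BY THE VERTEX SUM WITH THE LEG MASSES INLINE**: `|k₁(b,b′)| ≤ C_G·Σ_{w,w′∈W}(Σ_{u∈U b}|q̇(u;b,b+w)|)(Σ_{u′∈U b′}|q̇(u′;b′,b′+w′)|)|Γ₀(b+w,b′+w′)|` under the plain sup
letter `|G| ≤ C_G` (FILE B's `abs_mix1_le_vertexSum` before its uniform-mass step). [folklore] -/
theorem abs_mix1_le_vertexMass (hG : ∀ u u', |G u u'| ≤ C_G) (b b' : Pt) :
    |∑ u ∈ U b, ∑ u' ∈ U b', G u' u *
        ∑ w ∈ W, ∑ w' ∈ W, qd u b (b + w) * Γ (b + w) (b' + w') * qd u' b' (b' + w')|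
      ≤ C_G * ∑ w ∈ W, ∑ w' ∈ W, |Γ (b + w) (b' + w')| *
          ((∑ u ∈ U b, |qd u b (b + w)|) * (∑ u' ∈ U b', |qd u' b' (b' + w')|)) := by
  have hCG : 0 ≤ C_G := (abs_nonneg _).trans (hG b b)
  have h1 : |∑ u ∈ U b, ∑ u' ∈ U b', G u' u *
        ∑ w ∈ W, ∑ w' ∈ W, qd u b (b + w) * Γ (b + w) (b' + w') * qd u' b' (b' + w')|
      ≤ ∑ u ∈ U b, ∑ u' ∈ U b', ∑ w ∈ W, ∑ w' ∈ W,
          C_G * (|qd u b (b + w)| * |Γ (b + w) (b' + w')| * |qd u' b' (b' + w')|) := by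
    refine (Finset.abs_sum_le_sum_abs _ _).trans (Finset.sum_le_sum fun u _ =>
      (Finset.abs_sum_le_sum_abs _ _).trans (Finset.sum_le_sum fun u' _ => ?_))
    rw [abs_mul]
    refine (mul_le_mul (hG u' u) ((Finset.abs_sum_le_sum_abs _ _).trans (Finset.sum_le_sum fun w _ =>
      Finset.abs_sum_le_sum_abs _ _)) (abs_nonneg _) hCG).trans (le_of_eq ?_)
    rw [Finset.mul_sum]
    refine Finset.sum_congr rfl fun w _ => ?_
    rw [Finset.mul_sum]
    exact Finset.sum_congr rfl fun w' _ => by rw [abs_mul, abs_mul]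
  have h2 : ∑ u ∈ U b, ∑ u' ∈ U b', ∑ w ∈ W, ∑ w' ∈ W,
          C_G * (|qd u b (b + w)| * |Γ (b + w) (b' + w')| * |qd u' b' (b' + w')|)
      = C_G * ∑ w ∈ W, ∑ w' ∈ W, |Γ (b + w) (b' + w')| *
          ((∑ u ∈ U b, |qd u b (b + w)|) * (∑ u' ∈ U b', |qd u' b' (b' + w')|)) := by
    rw [sum_comm₄, Finset.mul_sum]
    refine Finset.sum_congr rfl fun w _ => ?_
    rw [Finset.mul_sum]
    refine Finset.sum_congr rfl fun w' _ => ?_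
    rw [Finset.sum_mul_sum, Finset.mul_sum, Finset.mul_sum]
    refine Finset.sum_congr rfl fun u _ => ?_
    rw [Finset.mul_sum, Finset.mul_sum]
    exact Finset.sum_congr rfl fun u' _ => by ring
  exact h1.trans (le_of_eq h2)

/-- [folklore] **THE Γ₀ PROFILE PAYS THE PAIR WEIGHT**: for `c = b + w`, `c′ = b′ + w′` with `‖w‖, ‖w′‖ ≤ R·n`,
`|Γ₀(c,c′)|·(1 + (‖b′−b‖∕n)²) ≤ C_Γ·(3 + 8R²)·((‖c−c′‖+1)⁻² + n⁻²)·e^{−(δ∕(2n))‖c−c′‖}` (`‖b′−b‖ ≤ ‖c−c′‖ + 2Rn`, `‖y‖²∕(‖y‖+1)² ≤ 1`, `e^{−(δ∕n)} ≤ e^{−(δ∕2n)}`). -/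
theorem profile_weight_le (hδ : 0 < δ) (hn : 1 ≤ n) (hW : ∀ w ∈ W, supNorm w ≤ R * n)
    (hΓ : ∀ c c', |Γ c c'| ≤ C_Γ / ((supNorm (c - c') : ℝ) + 1) ^ 2 * Real.exp (-(δ / n) * (supNorm (c - c') : ℝ)))
    {b b' w w' : Pt} (hw : w ∈ W) (hw' : w' ∈ W) :
    |Γ (b + w) (b' + w')| * (1 + ((supNorm (b' - b) : ℝ) / n) ^ 2)
      ≤ C_Γ * (3 + 8 * (R : ℝ) ^ 2) * (1 / ((supNorm (b + w - (b' + w')) : ℝ) + 1) ^ 2 + ((n : ℝ) ^ 2)⁻¹)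
          * Real.exp (-(δ / (2 * n)) * (supNorm (b + w - (b' + w')) : ℝ)) := by
  have hn' : (0 : ℝ) < n := by exact_mod_cast hn
  have hCΓ : 0 ≤ C_Γ := by
    have h := hΓ b b
    rw [sub_self, show supNorm (0 : Pt) = 0 from
      Literature.MathematicalPhysics.QuantumFieldTheory.Balaban1983to89.Beta.DyadicShell.supNorm_eq_zero_iff.mpr rfl] at h
    norm_num at h
    exact (abs_nonneg _).trans h
  set y : Pt := b + w - (b' + w') with hy
  have hys := supNorm_cast_nonneg y
  have h1 : (0 : ℝ) < (supNorm y : ℝ) + 1 := by linarith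
  -- `‖b′ − b‖ ≤ ‖y‖ + 2Rn`
  have htri : (supNorm (b' - b) : ℝ) ≤ (supNorm y : ℝ) + 2 * ((R : ℝ) * n) := by
    have e : b' - b = w - w' - y := by rw [hy]; abel
    have h2 := supNorm_sub_le_real (w - w') y
    have h3 := supNorm_sub_le_real w w'
    have h4 : (supNorm w : ℝ) ≤ R * n := by exact_mod_cast hW w hw
    have h5 : (supNorm w' : ℝ) ≤ R * n := by exact_mod_cast hW w' hw'
    rw [e]; linarith
  have hsq : ((supNorm (b' - b) : ℝ) / n) ^ 2 ≤ 2 * ((supNorm y : ℝ) / n) ^ 2 + 8 * (R : ℝ) ^ 2 := by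
    have h0 : (0 : ℝ) ≤ (supNorm (b' - b) : ℝ) / n := by positivity
    have hd : (supNorm (b' - b) : ℝ) / n ≤ (supNorm y : ℝ) / n + 2 * R := by
      rw [div_add' _ _ _ hn'.ne', div_le_div_iff_of_pos_right hn']; linarith
    have h2 := pow_le_pow_left₀ h0 hd 2
    nlinarith [sq_nonneg ((supNorm y : ℝ) / n - 2 * R)]
  set E₁ : ℝ := Real.exp (-(δ / n) * (supNorm y : ℝ)) with hE₁
  set E₂ : ℝ := Real.exp (-(δ / (2 * n)) * (supNorm y : ℝ)) with hE₂
  have hE12 : E₁ ≤ E₂ := by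
    rw [hE₁, hE₂]; apply Real.exp_le_exp.mpr
    have : 0 ≤ δ / (2 * n) * (supNorm y : ℝ) := by positivity
    have e : δ / n = 2 * (δ / (2 * n)) := by field_simp
    rw [e]; nlinarith
  have hE₁0 : 0 < E₁ := Real.exp_pos _
  -- the two pieces
  have hprof : |Γ (b + w) (b' + w')| ≤ C_Γ / ((supNorm y : ℝ) + 1) ^ 2 * E₁ := hΓ _ _
  have hpiece1 : C_Γ / ((supNorm y : ℝ) + 1) ^ 2 * E₁ * (1 + 8 * (R : ℝ) ^ 2)
      ≤ C_Γ * (1 + 8 * (R : ℝ) ^ 2) * (1 / ((supNorm y : ℝ) + 1) ^ 2) * E₂ := by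
    have : C_Γ / ((supNorm y : ℝ) + 1) ^ 2 = C_Γ * (1 / ((supNorm y : ℝ) + 1) ^ 2) := by rw [mul_one_div]
    rw [this]
    have h0 : 0 ≤ C_Γ * (1 / ((supNorm y : ℝ) + 1) ^ 2) * (1 + 8 * (R : ℝ) ^ 2) := by positivity
    nlinarith [mul_le_mul_of_nonneg_left hE12 h0]
  have hpiece2 : C_Γ / ((supNorm y : ℝ) + 1) ^ 2 * E₁ * (2 * ((supNorm y : ℝ) / n) ^ 2) ≤ C_Γ * 2 * ((n : ℝ) ^ 2)⁻¹ * E₂ := by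
    -- `‖y‖²/(‖y‖+1)² ≤ 1`
    have hr : (supNorm y : ℝ) ^ 2 / ((supNorm y : ℝ) + 1) ^ 2 ≤ 1 := by
      rw [div_le_one (pow_pos h1 2)]; gcongr; linarith
    have e : C_Γ / ((supNorm y : ℝ) + 1) ^ 2 * E₁ * (2 * ((supNorm y : ℝ) / n) ^ 2)
        = C_Γ * 2 * ((n : ℝ) ^ 2)⁻¹ * E₁ * ((supNorm y : ℝ) ^ 2 / ((supNorm y : ℝ) + 1) ^ 2) := by
      field_simp
    rw [e]
    have h0 : 0 ≤ C_Γ * 2 * ((n : ℝ) ^ 2)⁻¹ := by positivity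
    calc C_Γ * 2 * ((n : ℝ) ^ 2)⁻¹ * E₁ * ((supNorm y : ℝ) ^ 2 / ((supNorm y : ℝ) + 1) ^ 2)
        ≤ C_Γ * 2 * ((n : ℝ) ^ 2)⁻¹ * E₁ * 1 := mul_le_mul_of_nonneg_left hr (by positivity)
      _ ≤ C_Γ * 2 * ((n : ℝ) ^ 2)⁻¹ * E₂ := by rw [mul_one]; exact mul_le_mul_of_nonneg_left hE12 h0
  calc |Γ (b + w) (b' + w')| * (1 + ((supNorm (b' - b) : ℝ) / n) ^ 2)
      ≤ (C_Γ / ((supNorm y : ℝ) + 1) ^ 2 * E₁) * ((1 + 8 * (R : ℝ) ^ 2) + 2 * ((supNorm y : ℝ) / n) ^ 2) :=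
        mul_le_mul hprof (by linarith) (by positivity) (by positivity)
    _ = C_Γ / ((supNorm y : ℝ) + 1) ^ 2 * E₁ * (1 + 8 * (R : ℝ) ^ 2)
        + C_Γ / ((supNorm y : ℝ) + 1) ^ 2 * E₁ * (2 * ((supNorm y : ℝ) / n) ^ 2) := by ring
    _ ≤ C_Γ * (1 + 8 * (R : ℝ) ^ 2) * (1 / ((supNorm y : ℝ) + 1) ^ 2) * E₂ + C_Γ * 2 * ((n : ℝ) ^ 2)⁻¹ * E₂ := add_le_add hpiece1 hpiece2
    _ ≤ C_Γ * (3 + 8 * (R : ℝ) ^ 2) * (1 / ((supNorm y : ℝ) + 1) ^ 2 + ((n : ℝ) ^ 2)⁻¹) * E₂ := by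
        have hE₂0 : 0 < E₂ := Real.exp_pos _
        have ha : 0 ≤ 1 / ((supNorm y : ℝ) + 1) ^ 2 := by positivity
        have hb : 0 ≤ ((n : ℝ) ^ 2)⁻¹ := by positivity
        have hR : (0 : ℝ) ≤ (R : ℝ) ^ 2 := by positivity
        nlinarith [mul_nonneg (mul_nonneg (mul_nonneg hCΓ hR) ha) hE₂0.le, mul_nonneg (mul_nonneg hCΓ hb) hE₂0.le,
          mul_nonneg (mul_nonneg (mul_nonneg hCΓ hR) hb) hE₂0.le, mul_nonneg (mul_nonneg hCΓ ha) hE₂0.le]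

/-- **THE WINDOWED MAJORANT OF (MIX-1)** from (M̃Γ) and (M): with `κ₁(b,b′) := C_G·Σ_{w,w′}m₁(b,w)m₁(b′,w′)|Γ₀(b+w,b′+w′)|`,
`Σ_{b,b′∈S} e^{−(δ∕(2n))‖b−n•v₀‖}(1 + ‖b′−b‖²∕n²)κ₁(b,b′) ≤ C_G·C_Γ(3 + 8R²)·Ã·A_M`. [folklore] -/
theorem windowedMajorant_mix1_le (hδ : 0 < δ) (hn : 1 ≤ n) (hW : ∀ w ∈ W, supNorm w ≤ R * n) (hG : ∀ u u', |G u u'| ≤ C_G)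
    (hΓ : ∀ c c', |Γ c c'| ≤ C_Γ / ((supNorm (c - c') : ℝ) + 1) ^ 2 * Real.exp (-(δ / n) * (supNorm (c - c') : ℝ)))
    (S : Finset Pt) (v₀ : Pt)
    (hMt : ∀ c : Pt, ∑ b' ∈ S, ∑ w' ∈ W, (1 / ((supNorm (c - (b' + w')) : ℝ) + 1) ^ 2 + ((n : ℝ) ^ 2)⁻¹) *
        Real.exp (-(δ / (2 * n)) * (supNorm (c - (b' + w')) : ℝ)) * (∑ u' ∈ U b', |qd u' b' (b' + w')|) ≤ Ã)
    (hM : ∑ b ∈ S, Real.exp (-(δ / (2 * n)) * (supNorm (b - (n : ℤ) • v₀) : ℝ)) * (∑ u ∈ U b, ∑ w ∈ W, |qd u b (b + w)|) ≤ A_M) :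
    ∑ b ∈ S, ∑ b' ∈ S, Real.exp (-(δ / (2 * n)) * (supNorm (b - (n : ℤ) • v₀) : ℝ)) * (1 + ((supNorm (b' - b) : ℝ) / n) ^ 2) *
        (C_G * ∑ w ∈ W, ∑ w' ∈ W, |Γ (b + w) (b' + w')| *
          ((∑ u ∈ U b, |qd u b (b + w)|) * (∑ u' ∈ U b', |qd u' b' (b' + w')|)))
      ≤ C_G * (C_Γ * (3 + 8 * (R : ℝ) ^ 2)) * Ã * A_M := by
  have hCG : 0 ≤ C_G := (abs_nonneg _).trans (hG v₀ v₀)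
  have hCΓ : 0 ≤ C_Γ := by
    have h := hΓ v₀ v₀
    rw [sub_self, show supNorm (0 : Pt) = 0 from
      Literature.MathematicalPhysics.QuantumFieldTheory.Balaban1983to89.Beta.DyadicShell.supNorm_eq_zero_iff.mpr rfl] at h
    norm_num at h
    exact (abs_nonneg _).trans h
  set m₁ : Pt → Pt → ℝ := fun b w => ∑ u ∈ U b, |qd u b (b + w)| with hm₁
  have hm₁0 : ∀ b w, 0 ≤ m₁ b w := fun b w => Finset.sum_nonneg fun u _ => abs_nonneg _
  set E : Pt → ℝ := fun b => Real.exp (-(δ / (2 * n)) * (supNorm (b - (n : ℤ) • v₀) : ℝ)) with hE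
  set ω : Pt → Pt → Pt → ℝ := fun c b' w' => (1 / ((supNorm (c - (b' + w')) : ℝ) + 1) ^ 2 + ((n : ℝ) ^ 2)⁻¹) *
      Real.exp (-(δ / (2 * n)) * (supNorm (c - (b' + w')) : ℝ)) with hω
  set K : ℝ := C_Γ * (3 + 8 * (R : ℝ) ^ 2) with hK
  have hK0 : 0 ≤ K := by positivity
  have hÃ : 0 ≤ Ã := le_trans (Finset.sum_nonneg fun b' _ => Finset.sum_nonneg fun w' _ => by positivity) (hMt v₀)
  -- for fixed `b`: the `b′`-sum against the field-point window
  have hinner : ∀ b ∈ S, ∑ b' ∈ S, (1 + ((supNorm (b' - b) : ℝ) / n) ^ 2) *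
      (C_G * ∑ w ∈ W, ∑ w' ∈ W, |Γ (b + w) (b' + w')| * (m₁ b w * m₁ b' w'))
        ≤ C_G * K * Ã * ∑ w ∈ W, m₁ b w := by
    intro b _
    -- termwise: profile pays the pair weight
    have h1 : ∀ b' ∈ S, (1 + ((supNorm (b' - b) : ℝ) / n) ^ 2) *
        (C_G * ∑ w ∈ W, ∑ w' ∈ W, |Γ (b + w) (b' + w')| * (m₁ b w * m₁ b' w'))
          ≤ C_G * K * ∑ w ∈ W, m₁ b w * ∑ w' ∈ W, ω (b + w) b' w' * m₁ b' w' := by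
      intro b' _
      have key : ∀ w ∈ W, ∀ w' ∈ W, (1 + ((supNorm (b' - b) : ℝ) / n) ^ 2) * (C_G * (|Γ (b + w) (b' + w')| * (m₁ b w * m₁ b' w')))
          ≤ C_G * (K * (m₁ b w * (ω (b + w) b' w' * m₁ b' w'))) := by
        intro w hw w' hw'
        have hp := profile_weight_le (Γ := Γ) hδ hn hW hΓ (b := b) (b' := b') hw hw'
        have h0 : 0 ≤ m₁ b w * m₁ b' w' := mul_nonneg (hm₁0 b w) (hm₁0 b' w')
        calc (1 + ((supNorm (b' - b) : ℝ) / n) ^ 2) * (C_G * (|Γ (b + w) (b' + w')| * (m₁ b w * m₁ b' w')))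
            = C_G * ((|Γ (b + w) (b' + w')| * (1 + ((supNorm (b' - b) : ℝ) / n) ^ 2)) * (m₁ b w * m₁ b' w')) := by ring
          _ ≤ C_G * ((K * ω (b + w) b' w') * (m₁ b w * m₁ b' w')) := by
              refine mul_le_mul_of_nonneg_left (mul_le_mul_of_nonneg_right (hp.trans (le_of_eq ?_)) h0) hCG
              rw [hK, hω]; ring
          _ = C_G * (K * (m₁ b w * (ω (b + w) b' w' * m₁ b' w'))) := by ring
      calc (1 + ((supNorm (b' - b) : ℝ) / n) ^ 2) * (C_G * ∑ w ∈ W, ∑ w' ∈ W, |Γ (b + w) (b' + w')| * (m₁ b w * m₁ b' w'))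
          = ∑ w ∈ W, ∑ w' ∈ W, (1 + ((supNorm (b' - b) : ℝ) / n) ^ 2) * (C_G * (|Γ (b + w) (b' + w')| * (m₁ b w * m₁ b' w'))) := by
            rw [Finset.mul_sum, Finset.mul_sum]
            exact Finset.sum_congr rfl fun w _ => by rw [Finset.mul_sum, Finset.mul_sum]
        _ ≤ ∑ w ∈ W, ∑ w' ∈ W, C_G * (K * (m₁ b w * (ω (b + w) b' w' * m₁ b' w'))) :=
            Finset.sum_le_sum fun w hw => Finset.sum_le_sum fun w' hw' => key w hw w' hw'
        _ = C_G * K * ∑ w ∈ W, m₁ b w * ∑ w' ∈ W, ω (b + w) b' w' * m₁ b' w' := by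
            rw [Finset.mul_sum]
            refine Finset.sum_congr rfl fun w _ => ?_
            rw [Finset.mul_sum, Finset.mul_sum]
            exact Finset.sum_congr rfl fun w' _ => by ring
    calc _ ≤ ∑ b' ∈ S, C_G * K * ∑ w ∈ W, m₁ b w * ∑ w' ∈ W, ω (b + w) b' w' * m₁ b' w' := Finset.sum_le_sum h1
      _ = C_G * K * ∑ w ∈ W, m₁ b w * ∑ b' ∈ S, ∑ w' ∈ W, ω (b + w) b' w' * m₁ b' w' := by
          rw [← Finset.mul_sum, Finset.sum_comm]
          congr 1
          refine Finset.sum_congr rfl fun w _ => ?_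
          rw [Finset.mul_sum]
      _ ≤ C_G * K * ∑ w ∈ W, m₁ b w * Ã := by
          refine mul_le_mul_of_nonneg_left (Finset.sum_le_sum fun w _ => mul_le_mul_of_nonneg_left ?_ (hm₁0 b w)) (by positivity)
          have h := hMt (b + w)
          simpa only [hω, hm₁] using h
      _ = C_G * K * Ã * ∑ w ∈ W, m₁ b w := by rw [← Finset.sum_mul]; ring
  calc _ = ∑ b ∈ S, E b * ∑ b' ∈ S, (1 + ((supNorm (b' - b) : ℝ) / n) ^ 2) *
          (C_G * ∑ w ∈ W, ∑ w' ∈ W, |Γ (b + w) (b' + w')| * (m₁ b w * m₁ b' w')) := by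
        refine Finset.sum_congr rfl fun b _ => ?_
        rw [Finset.mul_sum]
        exact Finset.sum_congr rfl fun b' _ => by ring
    _ ≤ ∑ b ∈ S, E b * (C_G * K * Ã * ∑ w ∈ W, m₁ b w) :=
        Finset.sum_le_sum fun b hb => mul_le_mul_of_nonneg_left (hinner b hb) (Real.exp_pos _).le
    _ = C_G * K * Ã * ∑ b ∈ S, E b * ∑ w ∈ W, m₁ b w := by
        rw [Finset.mul_sum]; exact Finset.sum_congr rfl fun b _ => by ring
    _ ≤ C_G * K * Ã * A_M := by
        refine mul_le_mul_of_nonneg_left ?_ (by positivity)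
        have e : ∀ b, ∑ w ∈ W, m₁ b w = ∑ u ∈ U b, ∑ w ∈ W, |qd u b (b + w)| := fun b => by rw [hm₁]; exact Finset.sum_comm
        simpa only [hE, e] using hM
    _ = C_G * (C_Γ * (3 + 8 * (R : ℝ) ^ 2)) * Ã * A_M := by rw [hK]

/-- **(MIX-1) MASS-CURRENCY COARSE SECOND MOMENT, n-FREE**: under (G₀), (Γ), (W), (J), (J′), (M̃Γ), (M), for finite fine window `S` and coarse window `V`,
`Σ_{v∈V}‖v−v₀‖∞²·|Σ_{b,b′∈S} J b v₀·J b′ v·k₁(b,b′)| ≤ 3·C_J·C_J′·(1 + 16∕δ²)·(C_G·C_Γ(3 + 8R²)·Ã·A_M)` — the J-contraction lemma at the majorant of `abs_mix1_le_vertexMass`.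
FILE B's `mix1_secondMoment_le` is the fine, uniform-letter special case. [folklore] -/
theorem coarse_mix1_secondMoment_le (hδ : 0 < δ) (hn : 1 ≤ n) (hW : ∀ w ∈ W, supNorm w ≤ R * n) (hG : ∀ u u', |G u u'| ≤ C_G)
    (hΓ : ∀ c c', |Γ c c'| ≤ C_Γ / ((supNorm (c - c') : ℝ) + 1) ^ 2 * Real.exp (-(δ / n) * (supNorm (c - c') : ℝ)))
    (S V : Finset Pt) (v₀ : Pt)
    (hJ : ∀ b, |J b v₀| ≤ C_J * Real.exp (-(δ / n) * (supNorm (b - (n : ℤ) • v₀) : ℝ)))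
    (hJ' : ∀ b', ∑ v ∈ V, (1 + ((supNorm (b' - (n : ℤ) • v) : ℝ) / n) ^ 2) * |J b' v| ≤ C_J')
    (hMt : ∀ c : Pt, ∑ b' ∈ S, ∑ w' ∈ W, (1 / ((supNorm (c - (b' + w')) : ℝ) + 1) ^ 2 + ((n : ℝ) ^ 2)⁻¹) *
        Real.exp (-(δ / (2 * n)) * (supNorm (c - (b' + w')) : ℝ)) * (∑ u' ∈ U b', |qd u' b' (b' + w')|) ≤ Ã)
    (hM : ∑ b ∈ S, Real.exp (-(δ / (2 * n)) * (supNorm (b - (n : ℤ) • v₀) : ℝ)) * (∑ u ∈ U b, ∑ w ∈ W, |qd u b (b + w)|) ≤ A_M) :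
    ∑ v ∈ V, (supNorm (v - v₀) : ℝ) ^ 2 *
        |∑ b ∈ S, ∑ b' ∈ S, J b v₀ * J b' v *
          (∑ u ∈ U b, ∑ u' ∈ U b', G u' u * ∑ w ∈ W, ∑ w' ∈ W, qd u b (b + w) * Γ (b + w) (b' + w') * qd u' b' (b' + w'))|
      ≤ 3 * C_J * C_J' * (1 + 16 / δ ^ 2) * (C_G * (C_Γ * (3 + 8 * (R : ℝ) ^ 2)) * Ã * A_M) :=
  coarse_secondMoment_of_majorant (J := J)
    (k := fun b b' => ∑ u ∈ U b, ∑ u' ∈ U b', G u' u * ∑ w ∈ W, ∑ w' ∈ W, qd u b (b + w) * Γ (b + w) (b' + w') * qd u' b' (b' + w'))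
    (κ := fun b b' => C_G * ∑ w ∈ W, ∑ w' ∈ W, |Γ (b + w) (b' + w')| *
      ((∑ u ∈ U b, |qd u b (b + w)|) * (∑ u' ∈ U b', |qd u' b' (b' + w')|)))
    hδ hn S V v₀ (fun b b' => abs_mix1_le_vertexMass (Γ := Γ) hG b b') hJ hJ' (windowedMajorant_mix1_le hδ hn hW hG hΓ S v₀ hMt hM)

end Mix1

end Summit.QuantumFields.BalabanUV.Beta.FP.MixLoopPowerCountingMassGamma

end
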